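import Literature.NumberTheory.EllipticCurves.NeronModel
import Literature.NumberTheory.DiophantineGeometry.TateAlgorithmProofs
import Literature.NumberTheory.DiophantineGeometry.LocalReductionProofs
import Literature.NumberTheory.EllipticCurves.SplitMultiplicativeNormalForm
import Literature.NumberTheory.EllipticCurves.SplitMultiplicativeIndex
import Literature.NumberTheory.EllipticCurves.VariableChangePointsMap
import Mathlib.AlgebraicGeometry.EllipticCurve.IsomOfJ
import Mathlib.FieldTheory.SeparableClosure
import HarnessLib

/-!
# Discharges for `NeronModel`: semistable reduction (`exists_finite_isSemistable`, Part A) and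
# `c_v = #Φ_v(k̄_v)` for split multiplicative reduction (Part B)

## Part A — `WeierstrassCurve.exists_finite_isSemistable`

This file proves the named fact `WeierstrassCurve.exists_finite_isSemistable` of
`Literature.NumberTheory.EllipticCurves.NeronModel` (kept in a sibling file so that the statement
file stays a definitions/named-facts file): for an elliptic curve `W` over the fraction field `K`
of a Dedekind domain `A` there is a finite separable extension `L / K` such that for every Dedekind
domain `B` with fraction field `L` (and `A → B → L`), `W / L` has good or multiplicative reduction
at every height-one prime of `B`.

The proof is Silverman's (*The Arithmetic of Elliptic Curves*, 2nd ed., Prop. VII.5.4(c),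
PDF pp. 175–176, for residue characteristic `≠ 2` via the Legendre normal form III.1.7,
PDF pp. 53–54; App. A, Prop. 1.3 and Cor. 1.4(a), PDF pp. 356–357, for residue characteristic
`≠ 3` via the Deuring normal form), made global by building **one** extension `L` from the
finitely many algebraic numbers involved:

1. *(criterion)* `WeierstrassCurve.isSemistableAt_of_isIntegral_of_valuation`: if some
   `L`-isomorphic equation `C • X` is `w`-integral with `w (Δ) = 1` or `w (c₄) = 1`, then `X` is
   semistable at `w` (AEC VII.5.1 and Remark VII.1.1: such an equation is minimal, and a minimal
   equation with unit `Δ`, resp. unit `c₄`, has good, resp. multiplicative, reduction). In Mathlib's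
   language (`WeierstrassCurve.IsMinimal` = maximality of the valuation of `Δ` among integral
   models) this is the elementary estimate `WeierstrassCurve.valuation_minimal_of_variableChange`.
2. *(local analysis)* for the Legendre equation `y² = x(x-1)(x-λ)` (`c₄ = 16(λ²-λ+1)`,
   `Δ = 16λ²(λ-1)²`) at a place `w` with `w (2) = 1`, and for the Deuring equation
   `y² + αxy + y = x³` (`c₄ = α(α³-24)`, `Δ = α³-27`) at a place with `w (3) = 1`, some rescaling
   (`u = √λ`, resp. `u = α`, when the parameter is not integral) is integral with unit `Δ` or unit
   `c₄` — Cases 1–3 of the proof of VII.5.4(c) and Cases I–III of the proof of A.1.4(a):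
   `WeierstrassCurve.exists_isIntegral_legendreForm`, `WeierstrassCurve.exists_isIntegral_deuringForm`.
   Every place has `w (2) = 1` or `w (3) = 1` (`Literature.NumberTheory.EllipticCurves.valuation_two_eq_one_or_valuation_three_eq_one`).
3. *(normal forms over `K^sep`)* over a separably closed extension `F` of `K`, `W` has a Legendre
   model if `2 ≠ 0` in `K` and a Deuring model if `3 ≠ 0` in `K`
   (`WeierstrassCurve.exists_variableChange_eq_legendreForm`,
   `WeierstrassCurve.exists_variableChange_eq_deuringForm`): the parameter is a root of
   `256(T²-T+1)³ - jT²(T-1)²` (III.1.7(b)), resp. `T³(T³-24)³ - j(T³-27)` (A.1.3), which has a root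
   in `F` because its derivative is non-zero (`Literature.NumberTheory.EllipticCurves.exists_aeval_eq_zero_of_derivative_ne_zero`:
   a polynomial with non-zero derivative has an irreducible factor with non-zero derivative, which
   is separable), except in the cases `char = 3, j = 0` (take `λ = -1`) and `char = 2, j = 0`
   (take `α = 0`); two elliptic curves with the same `j`-invariant are isomorphic over `F`
   (Mathlib's `WeierstrassCurve.exists_variableChange_of_j_eq`, AEC III.1.4(b) / A.1.2(b)).
4. *(assembly)* `L := K(S) ⊆ SeparableClosure K` for the finite set `S` of parameters and
   change-of-variable coefficients is finite and separable over `K`; the identities of curves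
   descend from `K^sep` to `L` (`WeierstrassCurve.smul_baseChange_eq_of_map_eq`), and at each place
   of `L` one dispatches on `w (2) = 1` (Legendre; then `2 ≠ 0` in `K`) or `w (3) = 1` (Deuring).

No new definitions are introduced: the Legendre and Deuring equations appear as the literal
Weierstrass curves `⟨0, -(1 + λ), 0, λ, 0⟩` and `⟨α, 0, 1, 0, 0⟩`.

## Conventions

Generic lemmas (separable roots, valuations of numerals) are in `namespace Literature`; everything about
Weierstrass equations is a deliberate dot-notation extension of Mathlib's
`namespace WeierstrassCurve` (and `WeierstrassCurve.VariableChange`), like the fact it discharges.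
The main theorem `WeierstrassCurve.exists_finite_isSemistable_holds` has exactly the parameters of
the fact (`A K : Type u`, `[CommRing A] [Field K] [Algebra A K]`, `W : WeierstrassCurve K`).

## References

* J. H. Silverman, *The Arithmetic of Elliptic Curves*, GTM 106, 2nd ed. 2009: III.1.4(b) and
  III.1.7 (PDF pp. 53–54), VII.1 Remark 1.1, VII.5.1 and Prop. VII.5.4 (PDF pp. 175–176), App. A
  Prop. 1.3 and Cor. 1.4 (PDF pp. 356–357).

## Part B — `Literature.NumberTheory.EllipticCurves.rationalComponents_eq_card_of_hasSplitMultiplicativeReductionAt`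

The named fact `Literature.NumberTheory.EllipticCurves.rationalComponents_eq_card_of_hasSplitMultiplicativeReductionAt` of
`NeronModel` says: for the component-group data `D : NeronComponentData W v` of an elliptic curve
with split multiplicative reduction at `v`, all components are rational, `#Φ_v(k_v) = #Φ_v(k̄_v)`
(Silverman, *ATAEC*, Cor. IV.9.2(b),(d); *AEC*, Thm. VII.6.1). It is proved here
(`Literature.NumberTheory.EllipticCurves.rationalComponents_eq_card_of_hasSplitMultiplicativeReductionAt_holds`, at the end of the
file), with no hypothesis on the residue field, in three steps.

1. *(reduction, Part B.1)* Unfolding the hypothesis structure (`fixedPointsEquiv : Φ_v(k_v) ≃+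
   E(K_v)/E₀(K_v)`, `card_eq : #Φ_v(k̄_v) = componentGroupOrder (kodairaSymbolAt v W)`) and
   Tate's algorithm, Step 2 (`WeierstrassCurve.kodairaSymbolAt_eq_I_iff_holds`: multiplicative
   reduction gives type `Iₙ`, `n = ord_v(Δ_min) ≥ 1`, `componentGroupOrder (Iₙ) = n`), the fact is
   equivalent, for each `D`, to the local index formula `#(E(K_v)/E₀(K_v)) = ord_v(Δ_min)`
   (`E = W.localMinimalModel v`, `E₀ = goodReductionSubgroup`), i.e. to the theorem of
   Kodaira–Néron and Tate (*ATAEC*, Cor. IV.9.2(d), Rem. IV.9.3, Rem. IV.9.6: over a complete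
   field `E(K)/E₀(K) ≅ K*/qᶻR* ≅ ℤ/nℤ`, `n = v(q) = v(Δ)`):
   `Literature.NumberTheory.EllipticCurves.rationalComponents_eq_card_of_hasSplitMultiplicativeReductionAt_of_natCard_quotient_eq`.
   Better, `fixedPointsEquiv` makes `E(K_v)/E₀(K_v)` a subgroup of the group `Φ_v(k̄_v)` of
   order `ord_v(Δ_min)`, so its order *divides* `ord_v(Δ_min)` and the fact follows from the
   lower bound alone, an injection `Fin (ord_v(Δ_min)) ↪ E(K_v)/E₀(K_v)`:
   `Literature.NumberTheory.EllipticCurves.rationalComponents_eq_card_of_hasSplitMultiplicativeReductionAt_of_exists_injective`.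
2. *(lower bound)* `Literature.NumberTheory.EllipticCurves.SplitMultiplicativeNormalForm` brings
   the minimal model, by a change of variables over the Henselian ring `O_v`
   (`Literature.RingTheory.DiscreteValuationRing.AdicCompletionHensel`), to Tate normal form
   `T : y² + xy = x³ + αϖⁿ`, `n = ord_v(Δ_min)`, and
   `Literature.NumberTheory.EllipticCurves.SplitMultiplicativeIndex` produces `n` points of
   `T(K_v)` pairwise incongruent modulo the subgroup of *big* points (`|x| ≥ 1`) by the
   elementary valuation estimates of Silverman, *ATAEC*, V.4, Lemmas 4.1.1–4.1.4.
3. *(assembly, Part B.3)* The isomorphism of point groups induced by the change of variables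
   (`VariableChange.pointEquiv`, `Affine.Point.congrEquiv`) maps `E₀(K_v)` into the big points
   (`Literature.NumberTheory.EllipticCurves.isBig_pointEquiv_of_isNonsingularReductionPoint`: reduction commutes with
   `O_v`-isomorphisms and the node of `ȳ² + x̄ȳ = x̄³` is `(0, 0)`), whence
   `Literature.NumberTheory.EllipticCurves.exists_fin_injective_quotient_goodReductionSubgroup` and the fact.

Also: `WeierstrassCurve.ordMinimalDiscriminant_ne_zero_of_hasMultiplicativeReductionAt`
(multiplicative reduction forces `ord_v(Δ_min) ≠ 0`, the easy direction of *AEC* VII.5.1) and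
`WeierstrassCurve.kodairaSymbolAt_eq_I_ordMinimalDiscriminant` (type `Iₙ`, `n = ord_v(Δ_min)`).

### References (Part B)

* J. H. Silverman, *Advanced Topics in the Arithmetic of Elliptic Curves*, GTM 151, 1994:
  Cor. IV.9.2(d) and Rem. IV.9.2.1, IV.9.3 (PDF pp. 340–341), Tate's algorithm IV.9.4 Step 2
  (PDF p. 344), Rem. IV.9.6 (PDF p. 355), proof of Cor. 9.2 (PDF pp. 356–357); §V.4, Prop. 4.1
  and Lemmas 4.1.1–4.1.4 (PDF pp. 402–405).
* J. H. Silverman, *The Arithmetic of Elliptic Curves*, 2nd ed., GTM 106, 2009, Prop. VII.2.1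
  and Thm. VII.6.1.
-/

open IsDedekindDomain Polynomial

/-! ### Separable roots and residue characteristics -/

namespace Literature.NumberTheory.EllipticCurves

/-- A polynomial over a field `K` whose derivative is not zero has a root in every separably
closed extension `F` of `K`: by induction on the degree, an irreducible factor `g` of `q` either has
`g' ≠ 0`, hence is separable and has a root in `F`, or `g' = 0` and then `q = g r` with
`q' = g r'`, so `r' ≠ 0` and `r` has smaller degree. (Used with the parameter polynomials of the
Legendre and Deuring families, Silverman AEC III.1.7(c) and A.1.3.) [folklore] -/
theorem exists_aeval_eq_zero_of_derivative_ne_zero {K : Type*} [Field K] {F : Type*} [Field F]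
    [Algebra K F] [IsSepClosed F] (q : K[X]) (hq : derivative q ≠ 0) :
    ∃ x : F, aeval x q = 0 := by
  suffices H : ∀ (n : ℕ) (q : K[X]), q.natDegree = n → derivative q ≠ 0 →
      ∃ x : F, aeval x q = 0 from H _ q rfl hq
  intro n
  induction n using Nat.strong_induction_on with
  | _ n ih =>
    intro q hn hq
    have hq0 : 0 < q.degree := by
      by_contra h
      rw [not_lt] at h
      rw [eq_C_of_degree_le_zero h, derivative_C] at hq
      exact hq rfl
    obtain ⟨g, hg, r, rfl⟩ := exists_irreducible_of_degree_pos hq0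
    by_cases hg' : derivative g = 0
    · have hr : derivative r ≠ 0 := by
        intro h; apply hq; rw [derivative_mul, hg', h, zero_mul, mul_zero, add_zero]
      have hr0 : r ≠ 0 := by rintro rfl; exact hr derivative_zero
      have hlt : r.natDegree < n := by
        rw [← hn, natDegree_mul hg.ne_zero hr0]
        have := hg.natDegree_pos
        omega
      obtain ⟨x, hx⟩ := ih _ hlt r rfl hr
      exact ⟨x, by rw [map_mul, hx, mul_zero]⟩
    · have hsep : g.Separable := (separable_iff_derivative_ne_zero hg).mpr hg'
      obtain ⟨x, hx⟩ :=
        IsSepClosed.exists_aeval_eq_zero F g (degree_pos_of_irreducible hg).ne' hsep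
      exact ⟨x, by rw [map_mul, hx, zero_mul]⟩

variable {B : Type*} [CommRing B] [IsDedekindDomain B] {L : Type*} [Field L] [Algebra B L]
  [IsFractionRing B L] (w : HeightOneSpectrum B)

/-- Natural numbers are `w`-integral: `w (n) ≤ 1`. [folklore] -/
theorem valuation_natCast_le_one (n : ℕ) : w.valuation L n ≤ 1 := by
  rw [← map_natCast (algebraMap B L)]
  exact HeightOneSpectrum.valuation_le_one w _

/-- Numerals are `w`-integral: `w (n) ≤ 1` (the `OfNat` form of
`Literature.NumberTheory.EllipticCurves.valuation_natCast_le_one`). [folklore] -/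
theorem valuation_ofNat_le_one (n : ℕ) [n.AtLeastTwo] : w.valuation L (ofNat(n) : L) ≤ 1 :=
  valuation_natCast_le_one w n

/-- Every finite place has residue characteristic `≠ 2` or `≠ 3`, i.e. `w (2) = 1` or `w (3) = 1`
(otherwise `w (1) = w (3 - 2) < 1`). [folklore] -/
theorem valuation_two_eq_one_or_valuation_three_eq_one :
    w.valuation L 2 = 1 ∨ w.valuation L 3 = 1 := by
  by_contra h
  rw [not_or] at h
  have h2 : w.valuation L 2 < 1 := (valuation_ofNat_le_one w 2).lt_of_ne h.1
  have h3 : w.valuation L 3 < 1 := (valuation_ofNat_le_one w 3).lt_of_ne h.2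
  have : w.valuation L (3 + -2) < 1 := Valuation.map_add_lt _ h3 (by rwa [Valuation.map_neg])
  norm_num at this

end Literature.NumberTheory.EllipticCurves

namespace WeierstrassCurve

/-! ### The criterion: an integral model with unit `Δ` or unit `c₄` -/

section MinimalCriterion

variable {R : Type*} [CommRing R] [IsDomain R] [IsDiscreteValuationRing R]
  {L : Type*} [Field L] [Algebra R L] [IsFractionRing R L]
  {Γ : Type*} [LinearOrderedCommGroupWithZero Γ] {V : Valuation L Γ}

omit [IsDomain R] [IsDiscreteValuationRing R] [IsFractionRing R L] in
/-- An `R`-integral Weierstrass equation has integral discriminant: `V (Δ) ≤ 1` for any valuation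
`V` whose valuation ring is `R`. Silverman, AEC VII.1 (Remark 1.1). [folklore] -/
theorem valuation_Δ_le_one_of_isIntegral
    (hV : ∀ x : L, V x ≤ 1 ↔ x ∈ (algebraMap R L).range) (X : WeierstrassCurve L)
    [X.IsIntegral R] : V X.Δ ≤ 1 :=
  (hV _).mpr ⟨_, integralModel_Δ_eq R X⟩

omit [IsDomain R] [IsDiscreteValuationRing R] [IsFractionRing R L] in
/-- An `R`-integral Weierstrass equation has integral `c₄`: `V (c₄) ≤ 1` for any valuation `V`
whose valuation ring is `R`. Silverman, AEC VII.1 (Remark 1.1). [folklore] -/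
theorem valuation_c₄_le_one_of_isIntegral
    (hV : ∀ x : L, V x ≤ 1 ↔ x ∈ (algebraMap R L).range) (X : WeierstrassCurve L)
    [X.IsIntegral R] : V X.c₄ ≤ 1 :=
  (hV _).mpr ⟨_, integralModel_c₄_eq R X⟩

/-- **Reduction type from an integral model with unit `Δ` or unit `c₄`.** Let `X` be an elliptic
curve over the fraction field `L` of a DVR `R`, `V` a valuation on `L` with valuation ring `R`, and
suppose some `L`-isomorphic equation `C • X` is `R`-integral with `V (Δ) = 1` or `V (c₄) = 1`.
Then Mathlib's chosen minimal model `X.minimal R` has `V (Δ_min) = 1` (good reduction), or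
`V (Δ_min) < 1` and `V (c₄,min) = 1` (multiplicative reduction). Indeed `C • X = D • X.minimal R`
for some `D`; minimality gives `V (Δ (C • X)) ≤ V (Δ_min)`, i.e. `V (u_D⁻¹) ≤ 1`, and then
`Δ (C • X) = u_D⁻¹² Δ_min`, `c₄ (C • X) = u_D⁻⁴ c₄,min` together with integrality of the minimal
model force the stated valuations. Silverman, AEC VII.1 Remark 1.1 (an integral equation with
`v (Δ) < 12` or `v (c₄) < 4` is minimal) and VII.5, Prop. 5.1(a),(b).
[cite: SilvermanAEC2009, VII.1 Remark 1.1 and VII.5 Prop. 5.1 (PDF pp. 165, 174)] -/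
theorem valuation_minimal_of_variableChange
    (hV : ∀ x : L, V x ≤ 1 ↔ x ∈ (algebraMap R L).range)
    (X : WeierstrassCurve L) [X.IsElliptic] (C : VariableChange L) (hC : (C • X).IsIntegral R)
    (h : V (C • X).Δ = 1 ∨ V (C • X).c₄ = 1) :
    V (X.minimal R).Δ = 1 ∨ (V (X.minimal R).Δ < 1 ∧ V (X.minimal R).c₄ = 1) := by
  set C₀ := (X.exists_isMinimal R).choose
  have hM : X.minimal R = C₀ • X := rfl
  obtain ⟨-, hMmin⟩ := (isMinimal_iff_of_le_one_iff hV (X.minimal R)).mp inferInstance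
  set D := C * C₀⁻¹ with hD
  have hDX : D • X.minimal R = C • X := by rw [hM, ← mul_smul, hD, inv_mul_cancel_right]
  have hle := hMmin D (hDX ▸ hC)
  rw [hDX] at hle
  have hΔ : (C • X).Δ = (↑D.u⁻¹ : L) ^ 12 * (X.minimal R).Δ := by rw [← hDX, variableChange_Δ]
  have hc₄ : (C • X).c₄ = (↑D.u⁻¹ : L) ^ 4 * (X.minimal R).c₄ := by rw [← hDX, variableChange_c₄]
  have hMΔ0 : V (X.minimal R).Δ ≠ 0 := by
    rw [Valuation.ne_zero_iff, hM, variableChange_Δ]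
    exact mul_ne_zero (pow_ne_zero _ (Units.ne_zero _)) (X.coe_Δ' ▸ X.Δ'.ne_zero)
  have hΔ1 := valuation_Δ_le_one_of_isIntegral hV (X.minimal R)
  have hc1 := valuation_c₄_le_one_of_isIntegral hV (X.minimal R)
  have hu : V (↑D.u⁻¹ : L) ≤ 1 := by
    rw [hΔ, Valuation.map_mul, Valuation.map_pow] at hle
    have h12 : V (↑D.u⁻¹ : L) ^ 12 ≤ 1 :=
      (mul_le_iff_le_one_left (zero_lt_iff.mpr hMΔ0)).mp hle
    exact (pow_le_one_iff (by norm_num)).mp h12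
  rcases h with h | h
  · left
    rw [hΔ, Valuation.map_mul, Valuation.map_pow] at h
    refine le_antisymm hΔ1 ?_
    calc (1 : Γ) = V (↑D.u⁻¹ : L) ^ 12 * V (X.minimal R).Δ := h.symm
      _ ≤ 1 * V (X.minimal R).Δ := by gcongr; exact pow_le_one' hu _
      _ = V (X.minimal R).Δ := one_mul _
  · rw [hc₄, Valuation.map_mul, Valuation.map_pow] at h
    have hc₄1 : V (X.minimal R).c₄ = 1 := by
      refine le_antisymm hc1 ?_
      calc (1 : Γ) = V (↑D.u⁻¹ : L) ^ 4 * V (X.minimal R).c₄ := h.symm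
        _ ≤ 1 * V (X.minimal R).c₄ := by gcongr; exact pow_le_one' hu _
        _ = V (X.minimal R).c₄ := one_mul _
    rcases hΔ1.lt_or_eq with h' | h'
    · exact Or.inr ⟨h', hc₄1⟩
    · exact Or.inl h'

end MinimalCriterion

section PlaceCriterion

variable {B : Type*} [CommRing B] [IsDedekindDomain B] {L : Type*} [Field L] [Algebra B L]
  [IsFractionRing B L] (w : HeightOneSpectrum B)

/-- **Semistability from an integral model with unit `Δ` or unit `c₄`** (place version of
`WeierstrassCurve.valuation_minimal_of_variableChange`): if an elliptic curve `X / L` has an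
`L`-isomorphic equation `C • X` with `w`-integral coefficients and `w (Δ) = 1` or `w (c₄) = 1`,
then `X` has good or multiplicative reduction at `w` (G22 `WeierstrassCurve.IsSemistableAt`,
computed on the local minimal model over `O_w ⊆ L_w`; integrality and `w` are read off in `L` via
`WeierstrassCurve.isIntegralAt_iff_isIntegral_integer` and `valued_algebraMap_adicCompletion`, and
Mathlib's valuation `valuation L_w (maximalIdeal O_w)` is equivalent to `Valued.v`).
Silverman, AEC VII.1 Remark 1.1 and VII.5 Prop. 5.1(a),(b).
[cite: SilvermanAEC2009, VII.1 Remark 1.1 and VII.5 Prop. 5.1 (PDF pp. 165, 174)] -/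
theorem isSemistableAt_of_isIntegral_of_valuation (X : WeierstrassCurve L) [X.IsElliptic]
    (C : VariableChange L) (hint : (C • X).IsIntegral (w.valuation L).integer)
    (h : w.valuation L (C • X).Δ = 1 ∨ w.valuation L (C • X).c₄ = 1) :
    X.IsSemistableAt w := by
  haveI : (X.baseChange (w.adicCompletion L)).IsElliptic :=
    inferInstanceAs (X.map (algebraMap L _)).IsElliptic
  have hV := valued_le_one_iff_mem_range_adicCompletionIntegers (K := L) w
  set Cw := C.map (algebraMap L (w.adicCompletion L)) with hCw
  have hCX : Cw • X.baseChange (w.adicCompletion L) = (C • X).baseChange (w.adicCompletion L) := by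
    simp only [hCw, baseChange, map_variableChange]
  have hint' : (Cw • X.baseChange (w.adicCompletion L)).IsIntegral (w.adicCompletionIntegers L) := by
    rw [hCX]
    exact (isIntegralAt_iff_isIntegral_integer w _).mpr hint
  have h' : Valued.v (Cw • X.baseChange (w.adicCompletion L)).Δ = 1 ∨
      Valued.v (Cw • X.baseChange (w.adicCompletion L)).c₄ = 1 := by
    rw [hCX]
    simp only [baseChange, map_Δ, map_c₄]
    erw [valued_algebraMap_adicCompletion, valued_algebraMap_adicCompletion]
    exact h
  have key := valuation_minimal_of_variableChange hV (X.baseChange (w.adicCompletion L)) Cw hint' h'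
  have hE := isEquiv_valuation_maximalIdeal_of_le_one_iff hV
  unfold IsSemistableAt HasGoodReductionAt HasMultiplicativeReductionAt localMinimalModel
  rcases key with h1 | ⟨h1, h2⟩
  · exact Or.inl ((hasGoodReduction_iff _ _).mpr ⟨inferInstance, hE.eq_one_iff_eq_one.mpr h1⟩)
  · exact Or.inr ((hasMultiplicativeReduction_iff _ _).mpr
      ⟨inferInstance, hE.lt_one_iff_lt_one.mpr h1, hE.eq_one_iff_eq_one.mpr h2⟩)

/-- `w`-integrality of a Weierstrass equation over `L`, coefficientwise: `X` is
`(w.valuation L).integer`-integral iff `w (aᵢ) ≤ 1` for `i = 1, 2, 3, 4, 6`. [folklore] -/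
theorem isIntegral_integer_iff (X : WeierstrassCurve L) :
    X.IsIntegral (w.valuation L).integer ↔ w.valuation L X.a₁ ≤ 1 ∧ w.valuation L X.a₂ ≤ 1 ∧
      w.valuation L X.a₃ ≤ 1 ∧ w.valuation L X.a₄ ≤ 1 ∧ w.valuation L X.a₆ ≤ 1 := by
  rw [isIntegral_iff_forall_mem_range]
  simp only [← valuation_le_one_iff_mem_range_integer]

end PlaceCriterion

/-! ### Legendre and Deuring equations: invariants and local analysis -/

section NormalForms

variable {R : Type*} [CommRing R]

/-- The Legendre equation `y² = x(x-1)(x-λ) = x³ - (1+λ)x² + λx` has `c₄ = 16(λ²-λ+1)`.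
Silverman, AEC, proof of VII.5.4(c). [cite: SilvermanAEC2009, proof of Prop. VII.5.4(c) (PDF p. 176)] -/
theorem legendreForm_c₄ (la : R) :
    (⟨0, -(1 + la), 0, la, 0⟩ : WeierstrassCurve R).c₄ = 16 * (1 + la * (la - 1)) := by
  simp only [c₄, b₂, b₄]; ring

/-- The Legendre equation `y² = x(x-1)(x-λ)` has `Δ = 16λ²(λ-1)²`.
Silverman, AEC, proof of VII.5.4(c). [cite: SilvermanAEC2009, proof of Prop. VII.5.4(c) (PDF p. 176)] -/
theorem legendreForm_Δ (la : R) :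
    (⟨0, -(1 + la), 0, la, 0⟩ : WeierstrassCurve R).Δ = 16 * (la * (la - 1)) ^ 2 := by
  simp only [Δ, b₂, b₄, b₆, b₈]; ring

/-- The Deuring equation `y² + αxy + y = x³` has `c₄ = α(α³-24)`.
Silverman, AEC, proof of A.1.4. [cite: SilvermanAEC2009, App. A, proof of Cor. 1.4 (PDF p. 356)] -/
theorem deuringForm_c₄ (α : R) :
    (⟨α, 0, 1, 0, 0⟩ : WeierstrassCurve R).c₄ = α * (α ^ 3 - 24) := by
  simp only [c₄, b₂, b₄]; ring

/-- The Deuring equation `y² + αxy + y = x³` has `Δ = α³ - 27`.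
Silverman, AEC, A.1.3. [cite: SilvermanAEC2009, App. A, Prop. 1.3 (PDF p. 356)] -/
theorem deuringForm_Δ (α : R) : (⟨α, 0, 1, 0, 0⟩ : WeierstrassCurve R).Δ = α ^ 3 - 27 := by
  simp only [Δ, b₂, b₄, b₆, b₈]; ring

/-- Legendre equations are preserved by ring homomorphisms. [folklore] -/
theorem map_legendreForm {S : Type*} [CommRing S] (f : R →+* S) (la : R) :
    (⟨0, -(1 + la), 0, la, 0⟩ : WeierstrassCurve R).map f = ⟨0, -(1 + f la), 0, f la, 0⟩ := by
  simp only [map]; ext <;> simp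

/-- Deuring equations are preserved by ring homomorphisms. [folklore] -/
theorem map_deuringForm {S : Type*} [CommRing S] (f : R →+* S) (α : R) :
    (⟨α, 0, 1, 0, 0⟩ : WeierstrassCurve R).map f = ⟨f α, 0, 1, 0, 0⟩ := by
  simp only [map]; ext <;> simp

variable {F : Type*} [Field F]

/-- Rescaling the Legendre equation `y² = x(x-1)(x-λ)`, `λ = μ²`, by `u = μ` gives the Legendre
equation with parameter `λ⁻¹` (Case 3 of the proof of AEC VII.5.4(c), where `√π` is adjoined for
this purpose). [cite: SilvermanAEC2009, proof of Prop. VII.5.4(c), Case 3 (PDF p. 176)] -/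
theorem variableChange_legendreForm_sq {m : F} (hm : m ≠ 0) :
    (⟨Units.mk0 m hm, 0, 0, 0⟩ : VariableChange F) •
        (⟨0, -(1 + m ^ 2), 0, m ^ 2, 0⟩ : WeierstrassCurve F) =
      ⟨0, -(1 + (m ^ 2)⁻¹), 0, (m ^ 2)⁻¹, 0⟩ := by
  simp only [variableChange_def]
  ext
  · simp
  · simp; field_simp; ring
  · simp
  · simp; field_simp
  · simp

/-- Rescaling the Deuring equation `y² + αxy + y = x³` (`α ≠ 0`) by `u = α` gives
`y² + xy + α⁻³y = x³` (Case III of the proof of AEC A.1.4(a), with `π^{-r} = α⁻¹`).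
[cite: SilvermanAEC2009, App. A, proof of Cor. 1.4(a), Case III (PDF p. 357)] -/
theorem variableChange_deuringForm {α : F} (hα : α ≠ 0) :
    (⟨Units.mk0 α hα, 0, 0, 0⟩ : VariableChange F) • (⟨α, 0, 1, 0, 0⟩ : WeierstrassCurve F) =
      ⟨1, 0, α⁻¹ ^ 3, 0, 0⟩ := by
  simp only [variableChange_def]
  ext
  · simp [inv_mul_cancel₀ hα]
  · simp
  · simp
  · simp
  · simp

end NormalForms

section LocalAnalysis

variable {B : Type*} [CommRing B] [IsDedekindDomain B] {L : Type*} [Field L] [Algebra B L]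
  [IsFractionRing B L] (w : HeightOneSpectrum B)

/-- **Legendre equation with integral parameter** at a place `w` of residue characteristic `≠ 2`
(`w (2) = 1`): `y² = x(x-1)(x-λ)` with `w (λ) ≤ 1` is `w`-integral, and either
`w (λ(λ-1)) = 1` and `Δ = 16λ²(λ-1)²` is a unit (Case 1: good reduction), or `w (λ(λ-1)) < 1` and
`c₄ = 16(1 + λ(λ-1))` is a unit (Case 2: multiplicative reduction).
[cite: SilvermanAEC2009, proof of Prop. VII.5.4(c), Cases 1–2 (PDF p. 176)] -/
theorem isIntegral_legendreForm (h2 : w.valuation L 2 = 1) {la : L}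
    (hla : w.valuation L la ≤ 1) :
    (⟨0, -(1 + la), 0, la, 0⟩ : WeierstrassCurve L).IsIntegral (w.valuation L).integer ∧
      (w.valuation L (⟨0, -(1 + la), 0, la, 0⟩ : WeierstrassCurve L).Δ = 1 ∨
        w.valuation L (⟨0, -(1 + la), 0, la, 0⟩ : WeierstrassCurve L).c₄ = 1) := by
  have h1 : w.valuation L (la - 1) ≤ 1 := Valuation.map_sub_le _ hla (by simp)
  have hp : w.valuation L (la * (la - 1)) ≤ 1 := by
    rw [Valuation.map_mul]; exact mul_le_one' hla h1
  have h16 : w.valuation L 16 = 1 := by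
    rw [show (16 : L) = 2 ^ 4 by norm_num, Valuation.map_pow, h2, one_pow]
  refine ⟨(isIntegral_integer_iff w _).mpr ⟨by simp, ?_, by simp, hla, by simp⟩, ?_⟩
  · rw [Valuation.map_neg]
    exact Valuation.map_add_le _ (by simp) hla
  · rcases hp.lt_or_eq with hp | hp
    · right
      rw [legendreForm_c₄, Valuation.map_mul, h16, one_mul, Valuation.map_one_add_of_lt _ hp]
    · left
      rw [legendreForm_Δ, Valuation.map_mul, Valuation.map_pow, hp, h16, one_pow, one_mul]

/-- **Local analysis of the Legendre equation** (all three cases of the proof of AEC VII.5.4(c)):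
at a place `w` with `w (2) = 1`, a Legendre equation `y² = x(x-1)(x-λ)` with `λ = μ² ≠ 0` has an
`L`-isomorphic equation (itself if `w (λ) ≤ 1`, its rescaling by `u = μ` — the Legendre equation
with parameter `λ⁻¹` — if `w (λ) > 1`) that is `w`-integral with unit `Δ` or unit `c₄`.
[cite: SilvermanAEC2009, proof of Prop. VII.5.4(c), Cases 1–3 (PDF p. 176)] -/
theorem exists_isIntegral_legendreForm (h2 : w.valuation L 2 = 1) {la m : L}
    (hm : m ^ 2 = la) (hla : la ≠ 0) :
    ∃ C : VariableChange L,
      (C • (⟨0, -(1 + la), 0, la, 0⟩ : WeierstrassCurve L)).IsIntegral (w.valuation L).integer ∧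
      (w.valuation L (C • (⟨0, -(1 + la), 0, la, 0⟩ : WeierstrassCurve L)).Δ = 1 ∨
        w.valuation L (C • (⟨0, -(1 + la), 0, la, 0⟩ : WeierstrassCurve L)).c₄ = 1) := by
  rcases le_or_gt (w.valuation L la) 1 with h | h
  · exact ⟨1, by rw [one_smul]; exact isIntegral_legendreForm w h2 h⟩
  · have hm0 : m ≠ 0 := by rintro rfl; exact hla (by rw [← hm]; ring)
    refine ⟨⟨Units.mk0 m hm0, 0, 0, 0⟩, ?_⟩
    rw [← hm, variableChange_legendreForm_sq hm0]
    refine isIntegral_legendreForm w h2 ?_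
    rw [map_inv₀, hm]
    exact inv_le_one_of_one_le₀ h.le

/-- **Deuring equation with integral parameter** at a place `w` of residue characteristic `≠ 3`
(`w (3) = 1`): `y² + αxy + y = x³` with `w (α) ≤ 1` is `w`-integral, and either `Δ = α³ - 27` is a
unit (Case I: good reduction), or `w (α³ - 27) < 1`, and then `w (α) = 1` and `w (α³ - 24) = 1`, so
`c₄ = α(α³ - 24)` is a unit (Case II: multiplicative reduction).
[cite: SilvermanAEC2009, App. A, proof of Cor. 1.4(a), Cases I–II (PDF pp. 356–357)] -/
theorem isIntegral_deuringForm (h3 : w.valuation L 3 = 1) {α : L} (hα : w.valuation L α ≤ 1) :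
    (⟨α, 0, 1, 0, 0⟩ : WeierstrassCurve L).IsIntegral (w.valuation L).integer ∧
      (w.valuation L (⟨α, 0, 1, 0, 0⟩ : WeierstrassCurve L).Δ = 1 ∨
        w.valuation L (⟨α, 0, 1, 0, 0⟩ : WeierstrassCurve L).c₄ = 1) := by
  have h27 : w.valuation L 27 = 1 := by
    rw [show (27 : L) = 3 ^ 3 by norm_num, Valuation.map_pow, h3, one_pow]
  have hΔ : w.valuation L (α ^ 3 - 27) ≤ 1 :=
    Valuation.map_sub_le _ (by rw [Valuation.map_pow]; exact pow_le_one' hα _) h27.le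
  refine ⟨(isIntegral_integer_iff w _).mpr ⟨hα, by simp, by simp, by simp, by simp⟩, ?_⟩
  rcases hΔ.lt_or_eq with hΔ | hΔ
  · right
    have h24 : w.valuation L (α ^ 3 - 24) = 1 := by
      rw [show α ^ 3 - 24 = 3 + (α ^ 3 - 27) by ring, Valuation.map_add_eq_of_lt_left _ (h3 ▸ hΔ),
        h3]
    have hα3 : w.valuation L (α ^ 3) = 1 := by
      rw [show α ^ 3 = 27 + (α ^ 3 - 27) by ring, Valuation.map_add_eq_of_lt_left _ (h27 ▸ hΔ),
        h27]
    have hα1 : w.valuation L α = 1 := by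
      refine hα.eq_or_lt.elim id fun hlt ↦ ?_
      have := pow_lt_one' hlt (n := 3) (by norm_num)
      rw [← Valuation.map_pow, hα3] at this
      exact absurd this (lt_irrefl _)
    rw [deuringForm_c₄, Valuation.map_mul, hα1, h24, one_mul]
  · left
    rw [deuringForm_Δ, hΔ]

/-- **Local analysis of the Deuring equation** (all three cases of the proof of AEC A.1.4(a)):
at a place `w` with `w (3) = 1`, a Deuring equation `y² + αxy + y = x³` has an `L`-isomorphic
equation (itself if `w (α) ≤ 1`, its rescaling `y² + xy + α⁻³y = x³` by `u = α` if `w (α) > 1`,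
which is integral with `c₄ = 1 - 24α⁻³ ≡ 1`) that is `w`-integral with unit `Δ` or unit `c₄`.
[cite: SilvermanAEC2009, App. A, proof of Cor. 1.4(a), Cases I–III (PDF pp. 356–357)] -/
theorem exists_isIntegral_deuringForm (h3 : w.valuation L 3 = 1) (α : L) :
    ∃ C : VariableChange L,
      (C • (⟨α, 0, 1, 0, 0⟩ : WeierstrassCurve L)).IsIntegral (w.valuation L).integer ∧
      (w.valuation L (C • (⟨α, 0, 1, 0, 0⟩ : WeierstrassCurve L)).Δ = 1 ∨
        w.valuation L (C • (⟨α, 0, 1, 0, 0⟩ : WeierstrassCurve L)).c₄ = 1) := by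
  rcases le_or_gt (w.valuation L α) 1 with h | h
  · exact ⟨1, by rw [one_smul]; exact isIntegral_deuringForm w h3 h⟩
  · have hα0 : α ≠ 0 := by rintro rfl; simp at h
    refine ⟨⟨Units.mk0 α hα0, 0, 0, 0⟩, ?_⟩
    rw [variableChange_deuringForm hα0]
    have hβ : w.valuation L (α⁻¹ ^ 3) < 1 := by
      rw [Valuation.map_pow, map_inv₀]
      exact pow_lt_one' (inv_lt_one_of_one_lt₀ h) (by norm_num)
    refine ⟨(isIntegral_integer_iff w _).mpr ⟨by simp, by simp, hβ.le, by simp, by simp⟩,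
      Or.inr ?_⟩
    have hc₄ : (⟨1, 0, α⁻¹ ^ 3, 0, 0⟩ : WeierstrassCurve L).c₄ = 1 - 24 * α⁻¹ ^ 3 := by
      simp only [c₄, b₂, b₄]; ring
    rw [hc₄]
    refine Valuation.map_one_sub_of_lt _ ?_
    rw [Valuation.map_mul]
    exact (mul_le_of_le_one_left' (Literature.NumberTheory.EllipticCurves.valuation_ofNat_le_one w 24)).trans_lt hβ

end LocalAnalysis

/-! ### Legendre and Deuring models over a separably closed field -/

section SepClosed

variable {K : Type*} [Field K] {F : Type*} [Field F] [Algebra K F] [IsSepClosed F]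

/-- **The Deuring parameter equation is solvable in `K^sep`.** If `3 ≠ 0` in `K`, then for every
`j ∈ K` the equation `α³(α³ - 24)³ - j(α³ - 27) = 0` of AEC A.1.3 has a solution in any separably
closed extension `F`: for `j = 0` take `α = 0`; otherwise the polynomial
`T¹² - 72T⁹ + 1728T⁶ - (13824 + j)T³ + 27j` has non-zero derivative (its `T¹¹`-coefficient is
`12`, its `T²`-coefficient is `-3(13824 + j)`, and `13824 = 2⁹·27`), so
`Literature.NumberTheory.EllipticCurves.exists_aeval_eq_zero_of_derivative_ne_zero` applies.
[cite: SilvermanAEC2009, App. A, Prop. 1.3 and its proof (PDF p. 356)] -/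
theorem exists_deuring_parameter (h3 : (3 : K) ≠ 0) (j : K) :
    ∃ α : F, α ^ 3 * (α ^ 3 - 24) ^ 3 - algebraMap K F j * (α ^ 3 - 27) = 0 := by
  by_cases hj : j = 0
  · exact ⟨0, by simp [hj]⟩
  set q : K[X] := X ^ 12 - C 72 * X ^ 9 + C 1728 * X ^ 6 - C (13824 + j) * X ^ 3 + C (27 * j)
    with hq
  have hq3 : q.coeff 3 = -(13824 + j) := by
    simp only [hq, coeff_add, coeff_sub, coeff_C_mul, coeff_X_pow, coeff_C]
    norm_num
  have hq12 : q.coeff 12 = 1 := by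
    simp only [hq, coeff_add, coeff_sub, coeff_C_mul, coeff_X_pow, coeff_C]
    norm_num
  have hd : derivative q ≠ 0 := by
    intro hd
    by_cases h2 : (2 : K) = 0
    · have := congr_arg (coeff · 2) hd
      simp only [coeff_derivative, coeff_zero] at this
      norm_num at this
      rw [hq3] at this
      have h13824 : (13824 : K) = 0 := by
        rw [show (13824 : K) = 2 * 6912 by norm_num, h2, zero_mul]
      rw [h13824, zero_add] at this
      exact this.elim (neg_ne_zero.mpr hj) h3
    · have := congr_arg (coeff · 11) hd
      simp only [coeff_derivative, coeff_zero] at this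
      norm_num at this
      rw [hq12] at this
      rw [show (12 : K) = 2 * 2 * 3 by norm_num] at this
      exact this.elim one_ne_zero (mul_ne_zero (mul_ne_zero h2 h2) h3)
  obtain ⟨x, hx⟩ := Literature.NumberTheory.EllipticCurves.exists_aeval_eq_zero_of_derivative_ne_zero (F := F) q hd
  refine ⟨x, ?_⟩
  rw [← hx, hq]
  simp [map_ofNat]
  ring

/-- **The Legendre parameter equation is solvable in `K^sep`.** If `2 ≠ 0` in `K`, then for every
`j ∈ K` the equation `256(λ² - λ + 1)³ - jλ²(λ - 1)² = 0` (AEC III.1.7(b):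
`j(E_λ) = 2⁸(λ²-λ+1)³/(λ²(λ-1)²)`) has a solution in any separably closed extension `F`: for
`char K = 3` and `j = 0` take `λ = -1`; otherwise the polynomial
`256T⁶ - 768T⁵ + (1536-j)T⁴ - (1792-2j)T³ + (1536-j)T² - 768T + 256` has non-zero derivative
(its constant coefficient is `-768 = -2⁸·3`, its `T`-coefficient is `2(1536 - j)`, and
`1536 = 3·2⁹`), so `Literature.NumberTheory.EllipticCurves.exists_aeval_eq_zero_of_derivative_ne_zero` applies.
[cite: SilvermanAEC2009, Prop. III.1.7(b),(c) (PDF pp. 53–54)] -/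
theorem exists_legendre_parameter (h2 : (2 : K) ≠ 0) (j : K) :
    ∃ la : F, 256 * (1 + la * (la - 1)) ^ 3 - algebraMap K F j * (la * (la - 1)) ^ 2 = 0 := by
  by_cases h : (3 : K) = 0 ∧ j = 0
  · refine ⟨-1, ?_⟩
    have h3F : (3 : F) = 0 := by rw [← map_ofNat (algebraMap K F) 3, h.1, map_zero]
    rw [h.2, map_zero, zero_mul, sub_zero, show (1 + (-1 : F) * (-1 - 1)) = 3 by ring, h3F]
    ring
  set q : K[X] := C 256 * X ^ 6 - C 768 * X ^ 5 + C (1536 - j) * X ^ 4 - C (1792 - 2 * j) * X ^ 3 +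
    C (1536 - j) * X ^ 2 - C 768 * X + C 256 with hq
  have hq1 : q.coeff 1 = -768 := by
    simp only [hq, coeff_add, coeff_sub, coeff_C_mul, coeff_X_pow, coeff_C, coeff_X]
    norm_num
  have hq2 : q.coeff 2 = 1536 - j := by
    simp only [hq, coeff_add, coeff_sub, coeff_C_mul, coeff_X_pow, coeff_C, coeff_X]
    norm_num
  have hd : derivative q ≠ 0 := by
    intro hd
    by_cases h3 : (3 : K) = 0
    · have hj : j ≠ 0 := fun hj ↦ h ⟨h3, hj⟩
      have := congr_arg (coeff · 1) hd
      simp only [coeff_derivative, coeff_zero] at this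
      norm_num at this
      rw [hq2] at this
      have h1536 : (1536 : K) = 0 := by
        rw [show (1536 : K) = 3 * 512 by norm_num, h3, zero_mul]
      rw [h1536, zero_sub] at this
      exact this.elim (neg_ne_zero.mpr hj) h2
    · have := congr_arg (coeff · 0) hd
      simp only [coeff_derivative, coeff_zero] at this
      norm_num at this
      rw [hq1, neg_eq_zero, show (768 : K) = 2 ^ 8 * 3 by norm_num] at this
      exact mul_ne_zero (pow_ne_zero _ h2) h3 this
  obtain ⟨x, hx⟩ := Literature.NumberTheory.EllipticCurves.exists_aeval_eq_zero_of_derivative_ne_zero (F := F) q hd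
  refine ⟨x, ?_⟩
  rw [← hx, hq]
  simp [map_ofNat]
  ring

/-- **Deuring normal form** (Silverman, AEC A.1.3): if `3 ≠ 0` in `K`, an elliptic curve `W / K`
becomes isomorphic, over any separably closed extension `F` of `K`, to a Deuring equation
`E_α : y² + αxy + y = x³` (`α³ ≠ 27` automatically). Proof as in loc. cit.: a root `α ∈ F` of
`α³(α³-24)³ - j(α³-27)` gives `E_α` with `Δ = α³ - 27 ≠ 0` (else `3⁶ = 0`) and `j(E_α) = j(W)`,
and curves with the same `j`-invariant are isomorphic over `F` (A.1.2(b) / III.1.4(b), Mathlib's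
`WeierstrassCurve.exists_variableChange_of_j_eq`).
[cite: SilvermanAEC2009, App. A, Prop. 1.3 (PDF p. 356)] -/
theorem exists_variableChange_eq_deuringForm (W : WeierstrassCurve K) [W.IsElliptic]
    (h3 : (3 : K) ≠ 0) :
    ∃ (α : F) (C : VariableChange F), C • W.baseChange F = ⟨α, 0, 1, 0, 0⟩ := by
  obtain ⟨α, hα⟩ := exists_deuring_parameter (F := F) h3 W.j
  have h3F : (3 : F) ≠ 0 := by
    rw [← map_ofNat (algebraMap K F) 3]; exact (_root_.map_ne_zero _).mpr h3
  have hΔ : (⟨α, 0, 1, 0, 0⟩ : WeierstrassCurve F).Δ ≠ 0 := by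
    rw [deuringForm_Δ]
    intro h
    have h27 : α ^ 3 = 27 := sub_eq_zero.mp h
    rw [h, mul_zero, sub_zero, h27] at hα
    have : (3 : F) ^ 6 = 0 := by rw [← hα]; norm_num
    exact h3F (pow_eq_zero_iff (by norm_num) |>.mp this)
  haveI : (⟨α, 0, 1, 0, 0⟩ : WeierstrassCurve F).IsElliptic := ⟨isUnit_iff_ne_zero.mpr hΔ⟩
  haveI : (W.baseChange F).IsElliptic := inferInstanceAs (W.map _).IsElliptic
  have hjW : (W.baseChange F).j = algebraMap K F W.j := W.map_j (algebraMap K F)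
  have hj : (W.baseChange F).j = (⟨α, 0, 1, 0, 0⟩ : WeierstrassCurve F).j := by
    rw [hjW]
    generalize algebraMap K F W.j = jF at hα ⊢
    rw [eq_comm, j, Units.inv_mul_eq_iff_eq_mul, coe_Δ', deuringForm_Δ, deuringForm_c₄]
    linear_combination hα
  obtain ⟨C, hC⟩ := exists_variableChange_of_j_eq _ _ hj
  exact ⟨α, C, hC⟩

/-- **Legendre normal form** (Silverman, AEC III.1.7(a), in the form used in the proof of
VII.5.4(c)): if `2 ≠ 0` in `K`, an elliptic curve `W / K` becomes isomorphic, over any separably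
closed extension `F` of `K`, to a Legendre equation `E_λ : y² = x(x-1)(x-λ)` with `λ ≠ 0` (and
`λ ≠ 1`), and `λ = μ²` is a square in `F`. Proof: a root `λ ∈ F` of `256(λ²-λ+1)³ - jλ²(λ-1)²`
(III.1.7(b)) has `λ(λ-1) ≠ 0` (else `2⁸ = 0`), so `E_λ` is an elliptic curve (`Δ = 16λ²(λ-1)²`)
with `j(E_λ) = j(W)`; conclude by III.1.4(b) (Mathlib's
`WeierstrassCurve.exists_variableChange_of_j_eq`); `√λ ∈ F` as `T² - λ` is separable.
[cite: SilvermanAEC2009, Prop. III.1.7(a),(b) (PDF pp. 53–54)] -/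
theorem exists_variableChange_eq_legendreForm (W : WeierstrassCurve K) [W.IsElliptic]
    (h2 : (2 : K) ≠ 0) :
    ∃ (la m : F) (C : VariableChange F), m ^ 2 = la ∧ la ≠ 0 ∧
      C • W.baseChange F = ⟨0, -(1 + la), 0, la, 0⟩ := by
  have h2F : (2 : F) ≠ 0 := by
    rw [← map_ofNat (algebraMap K F) 2]; exact (_root_.map_ne_zero _).mpr h2
  obtain ⟨la, hla⟩ := exists_legendre_parameter (F := F) h2 W.j
  have hp : la * (la - 1) ≠ 0 := by
    intro h
    have h256 : (256 : F) = 0 := by simpa [h] using hla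
    have : (2 : F) ^ 8 = 0 := by rw [← h256]; norm_num
    exact h2F (pow_eq_zero_iff (by norm_num) |>.mp this)
  have hla0 : la ≠ 0 := left_ne_zero_of_mul hp
  have h16 : (16 : F) ≠ 0 := by
    rw [show (16 : F) = 2 ^ 4 by norm_num]; exact pow_ne_zero _ h2F
  have hΔ : (⟨0, -(1 + la), 0, la, 0⟩ : WeierstrassCurve F).Δ ≠ 0 := by
    rw [legendreForm_Δ]; exact mul_ne_zero h16 (pow_ne_zero _ hp)
  haveI : (⟨0, -(1 + la), 0, la, 0⟩ : WeierstrassCurve F).IsElliptic :=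
    ⟨isUnit_iff_ne_zero.mpr hΔ⟩
  haveI : (W.baseChange F).IsElliptic := inferInstanceAs (W.map _).IsElliptic
  haveI : NeZero (2 : F) := ⟨h2F⟩
  obtain ⟨m, hm⟩ := IsSepClosed.exists_pow_nat_eq la 2
  have hjW : (W.baseChange F).j = algebraMap K F W.j := W.map_j (algebraMap K F)
  have hj : (W.baseChange F).j = (⟨0, -(1 + la), 0, la, 0⟩ : WeierstrassCurve F).j := by
    rw [hjW]
    generalize algebraMap K F W.j = jF at hla ⊢
    rw [eq_comm, j, Units.inv_mul_eq_iff_eq_mul, coe_Δ', legendreForm_Δ, legendreForm_c₄]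
    linear_combination 16 * hla
  obtain ⟨C, hC⟩ := exists_variableChange_of_j_eq _ _ hj
  exact ⟨la, m, C, hm, hla0, hC⟩

end SepClosed

/-! ### Descent from `K^sep` to a finite extension -/

section Descent

variable {K : Type*} [Field K] {L : Type*} [Field L] {F : Type*} [Field F]
  [Algebra K L] [Algebra K F] [Algebra L F] [IsScalarTower K L F]

/-- An identity `C • W_F = E_F` between the base change of `W / K` and the base change of an
equation `E / L`, for a change of variables `C` defined over the intermediate field `L`, already
holds over `L` (the coefficient map `L → F` is injective). [folklore] -/
theorem smul_baseChange_eq_of_map_eq (W : WeierstrassCurve K) (C : VariableChange L)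
    (E : WeierstrassCurve L)
    (h : C.map (algebraMap L F) • W.baseChange F = E.map (algebraMap L F)) :
    C • W.baseChange L = E := by
  apply map_injective (algebraMap L F).injective
  change (C • W.baseChange L).map (algebraMap L F) = E.map (algebraMap L F)
  rw [← h, ← map_variableChange]
  congr 1
  exact W.map_baseChange (IsScalarTower.toAlgHom K L F)

/-- A change of variables over `F` whose coefficients `u, r, s, t` lie in an intermediate field
`M` is the base change of a change of variables over `M`. [folklore] -/
theorem VariableChange.exists_map_eq_of_mem (M : IntermediateField K F) (C : VariableChange F)
    (hu : (C.u : F) ∈ M) (hr : C.r ∈ M) (hs : C.s ∈ M) (ht : C.t ∈ M) :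
    ∃ C' : VariableChange M, C'.map (algebraMap M F) = C := by
  refine ⟨⟨Units.mk0 ⟨C.u, hu⟩ ?_, ⟨C.r, hr⟩, ⟨C.s, hs⟩, ⟨C.t, ht⟩⟩, ?_⟩
  · exact fun h ↦ C.u.ne_zero (congr_arg Subtype.val h)
  · ext <;> rfl

end Descent

/-! ### The semistable reduction theorem -/

section Global

universe u

variable {A : Type u} [CommRing A] {K : Type u} [Field K] [Algebra A K] (W : WeierstrassCurve K)

/-- **Semistable reduction theorem** for elliptic curves, discharge of the named fact
`WeierstrassCurve.exists_finite_isSemistable` (Silverman, AEC, Prop. VII.5.4(c) with App. A,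
Cor. 1.4(a); Grothendieck, SGA 7 I, IX 3.6 for abelian varieties). For an elliptic curve `W` over
the fraction field `K` of a Dedekind domain `A`, let `F = K^sep` and let `S ⊆ F` consist of a
Legendre parameter `λ`, a square root `μ` of `λ` and the coefficients of a change of variables
`C_L` with `C_L • W_F : y² = x(x-1)(x-λ)` (if `2 ≠ 0` in `K`), together with a Deuring parameter
`α` and the coefficients of `C_D` with `C_D • W_F : y² + αxy + y = x³` (if `3 ≠ 0` in `K`). Then
`L := K(S)` is finite and separable over `K`, the two identities descend to `L`, and at every
height-one prime `w` of any Dedekind domain `B` with fraction field `L` either `w (2) = 1`, and the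
local analysis of the Legendre equation applies, or `w (3) = 1`, and that of the Deuring equation
applies; in both cases `W / L` has an `L`-isomorphic `w`-integral equation with unit `Δ` or unit
`c₄`, hence good or multiplicative reduction at `w`.
[cite: SilvermanAEC2009, Prop. VII.5.4(c) (PDF pp. 175–176) with App. A Cor. 1.4(a) (PDF pp. 356–357)] -/
theorem exists_finite_isSemistable_holds : W.exists_finite_isSemistable (A := A) := by
  intro _
  let F := SeparableClosure K
  obtain ⟨SL, hSLfin, hSL⟩ : ∃ S : Set F, S.Finite ∧ ((2 : K) ≠ 0 →
      ∃ (la m : F) (C : VariableChange F), la ∈ S ∧ m ∈ S ∧ (C.u : F) ∈ S ∧ C.r ∈ S ∧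
        C.s ∈ S ∧ C.t ∈ S ∧ m ^ 2 = la ∧ la ≠ 0 ∧
          C • W.baseChange F = ⟨0, -(1 + la), 0, la, 0⟩) := by
    by_cases h2 : (2 : K) = 0
    · exact ⟨∅, Set.finite_empty, fun h ↦ (h h2).elim⟩
    · obtain ⟨la, m, C, hm, hla, hC⟩ := exists_variableChange_eq_legendreForm (F := F) W h2
      exact ⟨{la, m, (C.u : F), C.r, C.s, C.t}, Set.toFinite _, fun _ ↦
        ⟨la, m, C, by simp, by simp, by simp, by simp, by simp, by simp, hm, hla, hC⟩⟩
  obtain ⟨SD, hSDfin, hSD⟩ : ∃ S : Set F, S.Finite ∧ ((3 : K) ≠ 0 →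
      ∃ (α : F) (C : VariableChange F), α ∈ S ∧ (C.u : F) ∈ S ∧ C.r ∈ S ∧ C.s ∈ S ∧
        C.t ∈ S ∧ C • W.baseChange F = ⟨α, 0, 1, 0, 0⟩) := by
    by_cases h3 : (3 : K) = 0
    · exact ⟨∅, Set.finite_empty, fun h ↦ (h h3).elim⟩
    · obtain ⟨α, C, hC⟩ := exists_variableChange_eq_deuringForm (F := F) W h3
      exact ⟨{α, (C.u : F), C.r, C.s, C.t}, Set.toFinite _, fun _ ↦
        ⟨α, C, by simp, by simp, by simp, by simp, by simp, hC⟩⟩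
  let L : IntermediateField K F := IntermediateField.adjoin K (SL ∪ SD)
  have hSL_sub : SL ⊆ L := fun x hx ↦ IntermediateField.subset_adjoin K _ (Or.inl hx)
  have hSD_sub : SD ⊆ L := fun x hx ↦ IntermediateField.subset_adjoin K _ (Or.inr hx)
  haveI : FiniteDimensional K L := by
    haveI : Finite ↑(SL ∪ SD) := (hSLfin.union hSDfin).to_subtype
    exact IntermediateField.finiteDimensional_adjoin fun x _ ↦ Algebra.IsSeparable.isIntegral K x
  haveI : Algebra.IsSeparable K L := Algebra.isSeparable_tower_bot_of_isSeparable K L F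
  letI : Algebra A L := ((algebraMap K L).comp (algebraMap A K)).toAlgebra
  haveI : IsScalarTower A K L := IsScalarTower.of_algebraMap_eq' rfl
  refine ⟨L, inferInstance, inferInstance, inferInstance, inferInstance, inferInstance,
    inferInstance, ?_⟩
  intro B _ _ _ _ _ _ w
  haveI : (W.baseChange L).IsElliptic := inferInstanceAs (W.map _).IsElliptic
  rcases Literature.NumberTheory.EllipticCurves.valuation_two_eq_one_or_valuation_three_eq_one (L := L) w with h2 | h3
  · -- residue characteristic `≠ 2`: Legendre form (AEC VII.5.4(c))
    have h2K : (2 : K) ≠ 0 := by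
      intro h
      have : (2 : L) = 0 := by rw [← map_ofNat (algebraMap K L) 2, h, map_zero]
      rw [this, Valuation.map_zero] at h2
      exact zero_ne_one h2
    obtain ⟨la, m, C, hlaS, hmS, huS, hrS, hsS, htS, hm, hla, hC⟩ := hSL h2K
    obtain ⟨C', hC'⟩ := VariableChange.exists_map_eq_of_mem L C (hSL_sub huS) (hSL_sub hrS)
      (hSL_sub hsS) (hSL_sub htS)
    let la' : L := ⟨la, hSL_sub hlaS⟩
    let m' : L := ⟨m, hSL_sub hmS⟩
    have hm' : m' ^ 2 = la' := Subtype.ext hm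
    have hla' : la' ≠ 0 := fun h ↦ hla (congr_arg Subtype.val h)
    have hCL : C' • W.baseChange L = ⟨0, -(1 + la'), 0, la', 0⟩ := by
      apply smul_baseChange_eq_of_map_eq (F := F)
      rw [hC', map_legendreForm, hC]
      rfl
    obtain ⟨C'', hint, hunit⟩ := exists_isIntegral_legendreForm w h2 hm' hla'
    refine isSemistableAt_of_isIntegral_of_valuation w (W.baseChange L) (C'' * C') ?_ ?_
    · rwa [mul_smul, hCL]
    · rwa [mul_smul, hCL]
  · -- residue characteristic `≠ 3`: Deuring form (AEC A.1.4(a))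
    have h3K : (3 : K) ≠ 0 := by
      intro h
      have : (3 : L) = 0 := by rw [← map_ofNat (algebraMap K L) 3, h, map_zero]
      rw [this, Valuation.map_zero] at h3
      exact zero_ne_one h3
    obtain ⟨α, C, hαS, huS, hrS, hsS, htS, hC⟩ := hSD h3K
    obtain ⟨C', hC'⟩ := VariableChange.exists_map_eq_of_mem L C (hSD_sub huS) (hSD_sub hrS)
      (hSD_sub hsS) (hSD_sub htS)
    let α' : L := ⟨α, hSD_sub hαS⟩
    have hCL : C' • W.baseChange L = ⟨α', 0, 1, 0, 0⟩ := by
      apply smul_baseChange_eq_of_map_eq (F := F)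
      rw [hC', map_deuringForm, hC]
      rfl
    obtain ⟨C'', hint, hunit⟩ := exists_isIntegral_deuringForm w h3 α'
    refine isSemistableAt_of_isIntegral_of_valuation w (W.baseChange L) (C'' * C') ?_ ?_
    · rwa [mul_smul, hCL]
    · rwa [mul_smul, hCL]

end Global

end WeierstrassCurve

/-! ## Part B.1 — the split multiplicative fact reduces to a lower bound for `E(K_v)/E₀(K_v)` -/

noncomputable section

open scoped Classical

namespace WeierstrassCurve

section Local

variable {A : Type*} [CommRing A] [IsDedekindDomain A] {K : Type*} [Field K] [Algebra A K]
  [IsFractionRing A K] (v : HeightOneSpectrum A) (W : WeierstrassCurve K)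

/-- Multiplicative reduction at `v` forces `ord_v(Δ_min) ≥ 1`: the discriminant of the integral
local minimal model lies in the maximal ideal of `O_v` (`hasMultiplicativeReductionAt_iff_mem`) and
is nonzero for an elliptic curve, so its additive valuation is a positive natural number. This is
the direction "multiplicative ⟹ `v(Δ) > 0`" of Silverman, *AEC*, Prop. VII.5.1(b).
[cite: SilvermanAEC2009, VII.5 Prop. 5.1(b)] -/
theorem ordMinimalDiscriminant_ne_zero_of_hasMultiplicativeReductionAt [W.IsElliptic]
    (h : W.HasMultiplicativeReductionAt v) : W.ordMinimalDiscriminant v ≠ 0 := by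
  rw [hasMultiplicativeReductionAt_iff_mem] at h
  obtain ⟨hΔ, -⟩ := h
  haveI := W.isElliptic_localMinimalModel v
  -- the discriminant of the integral local minimal model is nonzero
  have hne : (W.localMinimalIntegralModel v).Δ ≠ 0 := by
    intro h0
    have h1 := integralModel_Δ_eq (v.adicCompletionIntegers K) (W.localMinimalModel v)
    have h2 : (W.localMinimalModel v).Δ ≠ 0 := (W.localMinimalModel v).isUnit_Δ.ne_zero
    apply h2
    rw [← h1]
    change algebraMap _ _ (W.localMinimalIntegralModel v).Δ = 0
    rw [h0, map_zero]
  unfold ordMinimalDiscriminant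
  intro h0
  rw [ENat.toNat_eq_zero] at h0
  rcases h0 with h0 | h0
  · rw [IsDiscreteValuationRing.addVal_eq_zero_iff] at h0
    exact (IsLocalRing.mem_maximalIdeal _ |>.mp hΔ) h0
  · exact hne (IsDiscreteValuationRing.addVal_eq_top_iff.mp h0)

/-- **Tate's algorithm, Step 2, for multiplicative reduction**: if `W` is elliptic with
multiplicative reduction at `v` then its Kodaira symbol at `v` is `Iₙ` with `n = ord_v(Δ_min)`
(from the discharged fact `kodairaSymbolAt_eq_I_iff_holds`). Silverman, *ATAEC*, IV.9.4, Step 2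
(PDF p. 344). [cite: SilvermanATAEC1994, IV.9.4 step 2] -/
theorem kodairaSymbolAt_eq_I_ordMinimalDiscriminant [W.IsElliptic]
    (h : W.HasMultiplicativeReductionAt v) :
    W.kodairaSymbolAt v = .I (W.ordMinimalDiscriminant v) :=
  (kodairaSymbolAt_eq_I_iff_holds v W
    (W.ordMinimalDiscriminant_ne_zero_of_hasMultiplicativeReductionAt v h)).mpr ⟨h, rfl⟩

end Local

end WeierstrassCurve

namespace Literature.NumberTheory.EllipticCurves

section ComponentGroup

variable {A : Type*} [CommRing A] [IsDedekindDomain A] {K : Type*} [Field K] [Algebra A K]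
  [IsFractionRing A K] {v : HeightOneSpectrum A} {W : WeierstrassCurve K}

/-- With the hypothesis structure `NeronComponentData`, the number of rational components is, by
`fixedPointsEquiv`, the index `[E(K_v) : E₀(K_v)]` computed on the local minimal model
(this is `localTamagawaNumber_eq_rationalComponents` read backwards, as a `Nat.card`). [folklore] -/
theorem NeronComponentData.rationalComponents_eq_natCard_quotient (D : NeronComponentData W v) :
    D.rationalComponents =
      Nat.card ((W.localMinimalModel v).toAffine.Point ⧸
        (W.localMinimalModel v).goodReductionSubgroup (v.adicCompletionIntegers K)) := by
  rw [D.rationalComponents_eq_card_rationalSubgroup, NeronComponentData.rationalSubgroup,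
    Nat.card_congr D.fixedPointsEquiv.toEquiv]

/-- For split multiplicative reduction, `#Φ_v(k̄_v)` as recorded by `NeronComponentData.card_eq`
is `ord_v(Δ_min)`: the Kodaira symbol is `Iₙ`, `n = ord_v(Δ_min) ≥ 1` (Tate's algorithm, Step 2),
and `componentGroupOrder (Iₙ) = n`. Silverman, *ATAEC*, IV.9.4 Step 2 and Table 4.1.
[cite: SilvermanATAEC1994, IV.9.4 step 2] -/
theorem NeronComponentData.card_eq_ordMinimalDiscriminant [W.IsElliptic]
    (D : NeronComponentData W v) (h : W.HasMultiplicativeReductionAt v) :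
    Fintype.card D.Φ = W.ordMinimalDiscriminant v := by
  rw [D.card_eq, W.kodairaSymbolAt_eq_I_ordMinimalDiscriminant v h,
    DiophantineGeometry.KodairaSymbol.componentGroupOrder_I]
  exact max_eq_left (Nat.one_le_iff_ne_zero.mpr
    (W.ordMinimalDiscriminant_ne_zero_of_hasMultiplicativeReductionAt v h))

/-- **Reduction of the named fact `rationalComponents_eq_card_of_hasSplitMultiplicativeReductionAt`
to the local index formula.** If, for the elliptic curve `W` with split multiplicative reduction at
`v`, the points of the local minimal model `E = W.localMinimalModel v` over the completion `K_v`
satisfy `#(E(K_v)/E₀(K_v)) = ord_v(Δ_min)` (`Nat.card` of the quotient by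
`goodReductionSubgroup`; Kodaira–Néron–Tate: Silverman, *AEC*, Thm. VII.6.1, *ATAEC*,
Cor. IV.9.2(d), Rem. IV.9.3 and Rem. IV.9.6), then every component-group datum `D` at `v` has all
its components rational, `#Φ_v(k_v) = #Φ_v(k̄_v)`. Both sides are rewritten to `ord_v(Δ_min)`:
the left by `fixedPointsEquiv` and the hypothesis, the right by `card_eq` and Tate's algorithm,
Step 2. No hypothesis on the residue field is needed for this reduction. [folklore] -/
theorem rationalComponents_eq_card_of_hasSplitMultiplicativeReductionAt_of_natCard_quotient_eq
    (hcard : ∀ [W.IsElliptic], W.HasSplitMultiplicativeReductionAt v →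
      Nat.card ((W.localMinimalModel v).toAffine.Point ⧸
          (W.localMinimalModel v).goodReductionSubgroup (v.adicCompletionIntegers K)) =
        W.ordMinimalDiscriminant v) :
    rationalComponents_eq_card_of_hasSplitMultiplicativeReductionAt (W := W) (v := v) := by
  intro _ D h
  rw [D.rationalComponents_eq_natCard_quotient, hcard h,
    D.card_eq_ordMinimalDiscriminant h.hasMultiplicativeReductionAt]

/-- **Refined reduction: only the lower bound is needed.** In the presence of a component-group
datum `D`, the quotient `E(K_v)/E₀(K_v)` is (via `fixedPointsEquiv`) a subgroup of the finite group
`Φ_v(k̄_v)` of order `ord_v(Δ_min)` (`card_eq` and Tate's algorithm, Step 2), so its order divides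
`ord_v(Δ_min)` (Lagrange). Hence the named fact
`rationalComponents_eq_card_of_hasSplitMultiplicativeReductionAt` already follows from the
existence, for split multiplicative reduction, of `ord_v(Δ_min)` points of the local minimal model
that are pairwise incongruent modulo `E₀(K_v)`, i.e. of an injection
`Fin (ord_v(Δ_min)) ↪ E(K_v)/E₀(K_v)` — the "easy half" `#E(K)/E₀(K) ≥ v(Δ)` of the theorem of
Kodaira–Néron–Tate (for the Tate curve this half is the surjectivity of `K* → E_q(K)`,
Silverman, *ATAEC*, V.3.1 and Rem. V.3.1.2; the other inequality is *ATAEC*, Prop. V.4.1).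
[folklore] -/
theorem rationalComponents_eq_card_of_hasSplitMultiplicativeReductionAt_of_exists_injective
    (hinj : ∀ [W.IsElliptic], W.HasSplitMultiplicativeReductionAt v →
      ∃ f : Fin (W.ordMinimalDiscriminant v) →
          (W.localMinimalModel v).toAffine.Point ⧸
            (W.localMinimalModel v).goodReductionSubgroup (v.adicCompletionIntegers K),
        Function.Injective f) :
    rationalComponents_eq_card_of_hasSplitMultiplicativeReductionAt (W := W) (v := v) := by
  intro _ D h
  obtain ⟨f, hf⟩ := hinj h
  have hn : Fintype.card D.Φ = W.ordMinimalDiscriminant v :=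
    D.card_eq_ordMinimalDiscriminant h.hasMultiplicativeReductionAt
  haveI : Finite ((W.localMinimalModel v).toAffine.Point ⧸
      (W.localMinimalModel v).goodReductionSubgroup (v.adicCompletionIntegers K)) :=
    Finite.of_equiv _ D.fixedPointsEquiv.toEquiv
  have hdvd : Nat.card ((W.localMinimalModel v).toAffine.Point ⧸
      (W.localMinimalModel v).goodReductionSubgroup (v.adicCompletionIntegers K)) ∣
        W.ordMinimalDiscriminant v := by
    rw [← hn, ← Nat.card_congr D.fixedPointsEquiv.toEquiv, ← Nat.card_eq_fintype_card]
    exact D.rationalSubgroup.card_addSubgroup_dvd_card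
  have hle : W.ordMinimalDiscriminant v ≤
      Nat.card ((W.localMinimalModel v).toAffine.Point ⧸
        (W.localMinimalModel v).goodReductionSubgroup (v.adicCompletionIntegers K)) := by
    simpa only [Nat.card_eq_fintype_card, Fintype.card_fin] using
      Nat.card_le_card_of_injective f hf
  have hpos : 0 < W.ordMinimalDiscriminant v := Nat.pos_of_ne_zero
    (W.ordMinimalDiscriminant_ne_zero_of_hasMultiplicativeReductionAt v
      h.hasMultiplicativeReductionAt)
  rw [D.rationalComponents_eq_natCard_quotient, hn]
  exact le_antisymm (Nat.le_of_dvd hpos hdvd) hle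

/-- Conversely, in the presence of a component-group datum `D` at `v`, the named fact
`rationalComponents_eq_card_of_hasSplitMultiplicativeReductionAt` *gives back* the local index
formula `#(E(K_v)/E₀(K_v)) = ord_v(Δ_min)` for split multiplicative reduction; so, granted the
existence of Néron component data (`nonempty_neronComponentData`), the fact and the local index
formula are equivalent. [folklore] -/
theorem natCard_quotient_eq_of_rationalComponents_eq_card [W.IsElliptic]
    (hsplit : rationalComponents_eq_card_of_hasSplitMultiplicativeReductionAt (W := W) (v := v))
    (D : NeronComponentData W v) (h : W.HasSplitMultiplicativeReductionAt v) :
    Nat.card ((W.localMinimalModel v).toAffine.Point ⧸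
        (W.localMinimalModel v).goodReductionSubgroup (v.adicCompletionIntegers K)) =
      W.ordMinimalDiscriminant v := by
  rw [← D.rationalComponents_eq_natCard_quotient, hsplit D h,
    D.card_eq_ordMinimalDiscriminant h.hasMultiplicativeReductionAt]

end ComponentGroup

end Literature.NumberTheory.EllipticCurves

/-! ## Part B.3 — assembly: the lower bound `#E(K_v)/E₀(K_v) ≥ ord_v(Δ_min)` and the named fact -/

namespace WeierstrassCurve.VariableChange

/-- The new `x`-coordinate commutes with ring homomorphisms: `f (C.toX x) = (C.map f).toX (f x)`
(`toX` is a polynomial in `u⁻¹, r, x`). [folklore] -/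
theorem map_toX_ringHom {R S : Type*} [CommRing R] [CommRing S] (f : R →+* S)
    (C : VariableChange R) (x : R) : f (C.toX x) = (C.map f).toX (f x) := by
  simp only [toX_def, VariableChange.map, Units.coe_map_inv, MonoidHom.coe_coe, map_mul, map_pow,
    map_sub]

end WeierstrassCurve.VariableChange

namespace Literature.NumberTheory.EllipticCurves

namespace TateNormalForm

/-- On the nodal cubic `y² + xy = x³` over a field, a nonsingular point has `x ≠ 0`: the only
point with `x = 0` is the node `(0, 0)`. [folklore] -/
theorem x_ne_zero_of_nonsingular_node {k : Type*} [Field k] {X Y : k}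
    (h : (⟨1, 0, 0, 0, 0⟩ : WeierstrassCurve k).toAffine.Nonsingular X Y) : X ≠ 0 := by
  rintro rfl
  rw [WeierstrassCurve.Affine.nonsingular_iff, WeierstrassCurve.Affine.equation_iff] at h
  obtain ⟨heq, hne⟩ := h
  have hY : Y = 0 := by simpa using heq
  subst hY
  simp at hne

end TateNormalForm

section SplitMultiplicativeLowerBound

open IsLocalRing WeierstrassCurve

variable {A : Type*} [CommRing A] [IsDedekindDomain A] {K : Type*} [Field K] [Algebra A K]
  [IsFractionRing A K] {v : HeightOneSpectrum A} {W : WeierstrassCurve K}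

/-- **Transport of `E₀` to the Tate normal form.** Let `D` be a change of variables over `O_v`
with `D • I = T_O := (y² + xy = x³ + a)`, `a ∈ 𝔪_v`, where `I` is the integral local minimal
model of `W` at `v`, and let `φ : M(K_v) ≃+ T(K_v)` be the induced isomorphism of point groups
(`M = W.localMinimalModel v`, `T = T_O ⊗ K_v`; `VariableChange.pointEquiv` composed with
`Affine.Point.congrEquiv`). Then every point of `M(K_v)` with nonsingular reduction is mapped to
a *big* point of `T` (`|x| ≥ 1`): a non-integral point has `|x| > 1`, hence `|u⁻²(x − r)| > 1`;
an integral point `(x₀, y₀)` with nonsingular reduction is mapped by the reduced change of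
variables `D̄` to a nonsingular point of the node `ȳ² + x̄ȳ = x̄³`, whose `x̄`-coordinate
`ū⁻²(x̄₀ − r̄)` is therefore nonzero, i.e. `|u⁻²(x₀ − r)| = 1`. (Reduction commutes with
`O_v`-isomorphisms: Silverman, *AEC*, VII.1–VII.2; *ATAEC*, Lemma V.4.1.1.) [folklore] -/
theorem isBig_pointEquiv_of_isNonsingularReductionPoint
    (D : VariableChange (v.adicCompletionIntegers K)) {a : v.adicCompletionIntegers K}
    (ha : a ∈ maximalIdeal (v.adicCompletionIntegers K))
    (hD : D • W.localMinimalIntegralModel v = ⟨1, 0, 0, 0, a⟩)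
    (hDM : D.baseChange (v.adicCompletion K) • W.localMinimalModel v =
      ⟨1, 0, 0, 0, (a : v.adicCompletion K)⟩)
    {P : (W.localMinimalModel v).toAffine.Point}
    (hP : (W.localMinimalModel v).IsNonsingularReductionPoint (v.adicCompletionIntegers K) P) :
    TateNormalForm.IsBig (⟨1, 0, 0, 0, (a : v.adicCompletion K)⟩ :
        WeierstrassCurve (v.adicCompletion K))
      (Affine.Point.congrEquiv hDM (VariableChange.pointEquiv (W.localMinimalModel v)
        (D.baseChange (v.adicCompletion K)) P)) := by
  rcases P with _ | ⟨x, y, hxy⟩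
  · rw [← Affine.Point.zero_def, map_zero, map_zero]
    exact TateNormalForm.isBig_zero
  rw [VariableChange.pointEquiv_some, Affine.Point.congrEquiv_some, TateNormalForm.isBig_some,
    VariableChange.toX_def, Valuation.map_mul, Valuation.map_pow]
  -- `|u⁻¹| = 1`, `|r| ≤ 1`
  have hint := TateNormalForm.integers_adicCompletionIntegers K v
  have hu : Valued.v (((D.baseChange (v.adicCompletion K)).u⁻¹ :
      (v.adicCompletion K)ˣ) : v.adicCompletion K) = 1 := by
    rw [VariableChange.baseChange, VariableChange.map_u, Units.coe_map_inv, MonoidHom.coe_coe]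
    exact hint.isUnit_iff_valuation_eq_one.mp (D.u⁻¹).isUnit
  have hr : (D.baseChange (v.adicCompletion K)).r = (D.r : v.adicCompletion K) := rfl
  rw [hu, one_pow, one_mul, hr]
  rcases hP with hx | ⟨x₀, y₀, rfl, rfl, hns⟩
  · -- non-integral point: `|x| > 1`
    have hx1 : 1 < Valued.v x := by
      by_contra hle
      rw [not_lt] at hle
      exact hx ⟨⟨x, (HeightOneSpectrum.mem_adicCompletionIntegers A K v).mpr hle⟩, rfl⟩
    have hlt : Valued.v (D.r : v.adicCompletion K) < Valued.v x :=
      lt_of_le_of_lt (TateNormalForm.v_coe_le_one _) hx1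
    rw [Valuation.map_sub_eq_of_lt_left _ hlt]
    exact hx1.le
  · -- integral point with nonsingular reduction
    change Valued.v ((x₀ : v.adicCompletion K) - D.r) ≥ 1
    have e : (x₀ : v.adicCompletion K) - D.r = ((x₀ - D.r : v.adicCompletionIntegers K) :
        v.adicCompletion K) := by norm_cast
    rw [e, ge_iff_le]
    -- `x₀ - r ∉ 𝔪`: the reduced point is a nonsingular point of the node `ȳ² + x̄ȳ = x̄³`
    by_contra hlt
    rw [not_le] at hlt
    have hmem : x₀ - D.r ∈ maximalIdeal (v.adicCompletionIntegers K) :=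
      (TateNormalForm.mem_maximalIdeal_iff_v_lt_one _).mpr hlt
    set k := ResidueField (v.adicCompletionIntegers K)
    set Dbar : VariableChange k := D.map (residue (v.adicCompletionIntegers K)) with hDbar
    have hred : (W.localMinimalModel v).reduction (v.adicCompletionIntegers K) =
        (W.localMinimalIntegralModel v).map (residue (v.adicCompletionIntegers K)) := rfl
    have hnode : Dbar • (W.localMinimalModel v).reduction (v.adicCompletionIntegers K) =
        (⟨1, 0, 0, 0, 0⟩ : WeierstrassCurve k) := by
      rw [hred, hDbar, map_variableChange, hD]
      ext <;> simp [WeierstrassCurve.map, (residue_eq_zero_iff _).mpr ha]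
    have hns' := (VariableChange.nonsingular_iff
      ((W.localMinimalModel v).reduction (v.adicCompletionIntegers K)) Dbar
      (residue _ x₀) (residue _ y₀)).mpr hns
    rw [hnode] at hns'
    apply TateNormalForm.x_ne_zero_of_nonsingular_node hns'
    rw [hDbar, ← VariableChange.map_toX_ringHom, VariableChange.toX_def, map_mul,
      (residue_eq_zero_iff _).mpr hmem, mul_zero]

/-- **The lower bound `#E(K_v)/E₀(K_v) ≥ ord_v(Δ_min)` for split multiplicative reduction.**
For an elliptic curve `W` with split multiplicative reduction at `v` there is an injection
`Fin (ord_v(Δ_min)) ↪ E(K_v)/E₀(K_v)` (`E = W.localMinimalModel v`,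
`E₀ = goodReductionSubgroup`): bring the minimal model to Tate normal form
`T : y² + xy = x³ + αϖⁿ`, `n = ord_v(Δ_min)`
(`exists_variableChange_localMinimalModel_eq_tateNormalForm`), take the `n` pairwise
incongruent points of `T(K_v)` modulo big points
(`TateNormalForm.exists_fin_injective_quotient`), and pull back along the isomorphism of
point groups, which maps `E₀(K_v)` into the big points
(`isBig_pointEquiv_of_isNonsingularReductionPoint`). This is the half "`≥`" of
`E(K)/E₀(K) ≅ ℤ/nℤ` (Silverman, *ATAEC*, Cor. IV.9.2(d), Rem. IV.9.6; *AEC*, Thm. VII.6.1).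
[cite: SilvermanATAEC1994, Cor. IV.9.2(d) (PDF p. 340) and Rem. IV.9.6 (PDF p. 355)] -/
theorem exists_fin_injective_quotient_goodReductionSubgroup [W.IsElliptic]
    (h : W.HasSplitMultiplicativeReductionAt v) :
    ∃ f : Fin (W.ordMinimalDiscriminant v) →
        (W.localMinimalModel v).toAffine.Point ⧸
          (W.localMinimalModel v).goodReductionSubgroup (v.adicCompletionIntegers K),
      Function.Injective f := by
  obtain ⟨ϖ, hϖ⟩ := IsDiscreteValuationRing.exists_irreducible (v.adicCompletionIntegers K)
  obtain ⟨D, α, hn1, hD, hDM⟩ :=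
    W.exists_variableChange_localMinimalModel_eq_tateNormalForm v h hϖ
  set n := W.ordMinimalDiscriminant v with hn
  set a : v.adicCompletionIntegers K := (α : v.adicCompletionIntegers K) * ϖ ^ n with ha_def
  have ha : a ∈ maximalIdeal (v.adicCompletionIntegers K) :=
    Ideal.mul_mem_left _ _ (Ideal.pow_mem_of_mem _
      ((mem_maximalIdeal _).mpr (mem_nonunits_iff.mpr hϖ.not_isUnit)) n hn1)
  change D.baseChange (v.adicCompletion K) • W.localMinimalModel v =
    ⟨1, 0, 0, 0, (a : v.adicCompletion K)⟩ at hDM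
  set T : WeierstrassCurve (v.adicCompletion K) := ⟨1, 0, 0, 0, (a : v.adicCompletion K)⟩
    with hT_def
  have hT : TateNormalForm.IsTateNormalForm T :=
    ⟨rfl, rfl, rfl, rfl, (TateNormalForm.mem_maximalIdeal_iff_v_lt_one a).mp ha⟩
  have haT : T.a₆ = (((α : v.adicCompletionIntegers K) * ϖ ^ n : v.adicCompletionIntegers K) :
      v.adicCompletion K) := rfl
  -- the isomorphism of point groups `M(K_v) ≃+ T(K_v)`
  set M := W.localMinimalModel v with hM
  let φ : M.toAffine.Point ≃+ T.toAffine.Point :=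
    (VariableChange.pointEquiv M (D.baseChange (v.adicCompletion K))).trans
      (Affine.Point.congrEquiv hDM)
  -- `E₀` is mapped into the big points
  set B : AddSubgroup T.toAffine.Point :=
    (M.goodReductionSubgroup (v.adicCompletionIntegers K)).map φ.toAddMonoidHom with hB
  have hBle : B ≤ TateNormalForm.bigSubgroup hT := by
    rw [hB, goodReductionSubgroup, AddSubgroup.map_le_iff_le_comap, AddSubgroup.closure_le]
    intro P hP
    exact isBig_pointEquiv_of_isNonsingularReductionPoint D ha hD hDM hP
  -- `n` pairwise incongruent points of `T(K_v)` modulo `B`, pulled back to `M(K_v)/E₀`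
  obtain ⟨g, hg⟩ := TateNormalForm.exists_fin_injective_quotient hT hϖ haT hn1 B
    (fun P hP => hBle hP)
  let ψ : M.toAffine.Point ⧸ M.goodReductionSubgroup (v.adicCompletionIntegers K) ≃+
      T.toAffine.Point ⧸ B :=
    QuotientAddGroup.congr _ _ φ rfl
  exact ⟨ψ.symm ∘ g, ψ.symm.injective.comp hg⟩

/-- **Discharge of the named fact
`Literature.NumberTheory.EllipticCurves.rationalComponents_eq_card_of_hasSplitMultiplicativeReductionAt`** (Silverman, *ATAEC*,
Cor. IV.9.2(b),(d); *AEC*, Thm. VII.6.1: for split multiplicative reduction all components of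
the special fibre of the Néron model are rational, `#Φ_v(k_v) = #Φ_v(k̄_v) = ord_v(Δ_min)`).
Proof: by `rationalComponents_eq_card_of_hasSplitMultiplicativeReductionAt_of_exists_injective`
(the datum makes `E(K_v)/E₀(K_v)` a subgroup of `Φ_v(k̄_v)`, of order `ord_v(Δ_min)` by Tate's
algorithm, Step 2) it suffices to exhibit `ord_v(Δ_min)` points of `E(K_v)` pairwise
incongruent modulo `E₀(K_v)`, which is `exists_fin_injective_quotient_goodReductionSubgroup`
(Tate normal form `y² + xy = x³ + αϖⁿ` over the Henselian ring `O_v` and the elementary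
estimates of *ATAEC*, V.4). No hypothesis on the residue field is needed.
[cite: SilvermanATAEC1994, Cor. IV.9.2 (b),(d) (PDF p. 340)] -/
theorem rationalComponents_eq_card_of_hasSplitMultiplicativeReductionAt_holds :
    rationalComponents_eq_card_of_hasSplitMultiplicativeReductionAt (W := W) (v := v) :=
  rationalComponents_eq_card_of_hasSplitMultiplicativeReductionAt_of_exists_injective
    fun h => exists_fin_injective_quotient_goodReductionSubgroup h

end SplitMultiplicativeLowerBound

end Literature.NumberTheory.EllipticCurves

end
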